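import Mathlib

/-!
# `GrenetZeon.DualUnipotentThreeHalves` (stmt-ValiantsHypothesis-24318), R2 `HeavyTopLaw` — the LINEAR CONSTRAINTS (T1)
# of the hand proof «ι(4) = 3» (htc cell, eng-1 `NOTE-iota4.md`; instrument, director R274/R280, htc-lead directive 16:24Z (ii))

`pub/val-heavytop-census/eng-1/NOTE-iota4.md` proves by hand that every linear space of nilpotent `4 × 4` complex matrices
of dimension `≥ 4` is reducible (`ι(4) = 3`, PREREG Q2; replication PASS by val-htc-lead).  Its tool (T1): if `A ∈ V` and
every member of `V` satisfies `M^p = 0`, then for every `B ∈ V` the `t`-coefficient of `(A + tB)^p = 0` vanishes,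
`Σ_{i+j=p−1} A^i B A^j = 0`.  This file types (T1) for the two normal forms the proof uses and the two «endings»:

* `firstOrder_of_cube` / `firstOrder_of_pow_four`: the operator identities `A³B + A²BA + ABA² + BA³ = 0` (from
  `M⁴ = 0` on `A`, `B`, `A ± B`, `A + 2B`) and `A²B + ABA + BA² = 0` (from `M³ = 0` on `A ± B`, `B`);
* `constraints_of_J4` (§2 of the note): `V ∋ J₄`, `M⁴ ≡ 0` on `V` ⇒ every `B ∈ V` has
  `B₄₁ = 0`, `B₃₁ + B₄₂ = 0`, `B₂₁ + B₃₂ + B₄₃ = 0` (and `tr B = 0`: `trace_eq_zero_of_pow_eq_zero`);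
* `constraints_of_E12_E23` (§3): `V ∋ A = E₁₂ + E₂₃`, `M³ ≡ 0` on `V` ⇒ `B₃₁ = B₄₁ = B₃₄ = 0`, `B₃₂ = −B₂₁`,
  `B₁₁ + B₂₂ + B₃₃ = 0` (hence `B₄₄ = 0` with the trace);
* endings: `mulVec_last_eq_zero_of_row_zero` (all members have zero 4th row ⇒ everything maps into the hyperplane
  `{x₄ = 0}`, an invariant hyperplane) and `mulVec_single_eq_zero_of_col_zero` (zero first column ⇒ `e₁` is a common
  kernel vector).

Indices are `Fin 4` = `{0,1,2,3}` (the note's `1…4`).  The graded-limit step (T2) and the case analysis stay with eng-1.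
Honest framing: lemmas for a datum of the instance table; nothing here proves or refutes `HeavyTopLaw`, 24318, S3b or
8062; `VP ≠ VNP` is not moved; no summit statement is proved here.  No definitions, no named facts. [eng-1 NOTE-iota4 (T1)]
-/

noncomputable section

-- single-conjunct layout: Sub = Summit, duplicated namespace component intended
set_option linter.dupNamespace false

namespace Summit.ValiantsHypothesis.ValiantsHypothesis.Theorems.GrenetZeon.HeavyTopIotaFour

open Matrix

/-! ## §1 First-order (t-coefficient) identities from nilpotency of a pencil `A + tB` -/

/-- **(T1), `p = 3`.**  If `B³ = 0`, `(A+B)³ = 0` and `(A−B)³ = 0` then the first-order term vanishes: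
`A²B + ABA + BA² = 0`. [NOTE-iota4 (T1)] -/
theorem firstOrder_of_cube {m : Type*} [Fintype m] [DecidableEq m] (A B : Matrix m m ℂ)
    (hB : B ^ 3 = 0) (hp : (A + B) ^ 3 = 0) (hm : (A - B) ^ 3 = 0) :
    A * A * B + A * B * A + B * A * A = 0 := by
  set L := A * A * B + A * B * A + B * A * A with hL
  have e1 : (A + B) ^ 3 - (A - B) ^ 3 = (L + L) + (B ^ 3 + B ^ 3) := by
    rw [hL]; noncomm_ring
  rw [hp, hm, hB, sub_zero, add_zero, add_zero] at e1
  ext i j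
  have f1 := congrFun (congrFun e1 i) j
  simp only [Matrix.add_apply, Matrix.zero_apply] at f1
  rw [Matrix.zero_apply]
  linear_combination (-1 / 2 : ℂ) * f1

/-- **(T1), `p = 4`.**  If `A⁴ = B⁴ = (A+B)⁴ = (A−B)⁴ = (A+B+B)⁴ = 0` then `A³B + A²BA + ABA² + BA³ = 0`. [NOTE-iota4 (T1)] -/
theorem firstOrder_of_pow_four {m : Type*} [Fintype m] [DecidableEq m] (A B : Matrix m m ℂ)
    (hA : A ^ 4 = 0) (hB : B ^ 4 = 0) (hp : (A + B) ^ 4 = 0) (hm : (A - B) ^ 4 = 0) (h2 : (A + B + B) ^ 4 = 0) :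
    A * A * A * B + A * A * B * A + A * B * A * A + B * A * A * A = 0 := by
  set L1 := A * A * A * B + A * A * B * A + A * B * A * A + B * A * A * A with hL1
  set L3 := A * B * B * B + B * A * B * B + B * B * A * B + B * B * B * A with hL3
  -- odd part of the binomial expansions: (A+B)⁴ − (A−B)⁴ = 2 L1 + 2 L3,
  -- (A+2B)⁴ − 2(A+B)⁴ − 2(A−B)⁴ + 3A⁴ − 12B⁴ = 2 L1 + 8 L3
  have e1 : (A + B) ^ 4 - (A - B) ^ 4 = (L1 + L1) + (L3 + L3) := by
    rw [hL1, hL3]; noncomm_ring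
  have e2 : (A + B + B) ^ 4 - 2 * (A + B) ^ 4 - 2 * (A - B) ^ 4 + 3 * A ^ 4 - 12 * B ^ 4 =
      (L1 + L1) + (L3 + L3 + L3 + L3 + L3 + L3 + L3 + L3) := by
    rw [hL1, hL3]; noncomm_ring
  rw [hp, hm, sub_zero] at e1
  rw [h2, hp, hm, hA, hB] at e2
  simp only [mul_zero, sub_zero, add_zero] at e2
  ext i j
  have f1 := congrFun (congrFun e1 i) j
  have f2 := congrFun (congrFun e2 i) j
  simp only [Matrix.add_apply, Matrix.zero_apply] at f1 f2
  rw [Matrix.zero_apply]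
  linear_combination (f2 - 4 * f1) / 6

/-- Members of a space of matrices with `M^p = 0` have trace zero. [folklore] -/
theorem trace_eq_zero_of_pow_eq_zero {m : Type*} [Fintype m] [DecidableEq m] (B : Matrix m m ℂ) {p : ℕ}
    (hB : B ^ p = 0) : B.trace = 0 :=
  (Matrix.isNilpotent_trace_of_isNilpotent ⟨p, hB⟩).eq_zero

/-! ## §2 `p = 4`: the constraints `V ⊆ T(J₄)` -/

/-- **`V ⊆ T(J₄)`** (NOTE-iota4 §2): if `V ∋ J₄ = E₁₂+E₂₃+E₃₄` is a linear space on which `M⁴ ≡ 0`, then every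
`B ∈ V` satisfies `B₄₁ = 0`, `B₃₁ + B₄₂ = 0`, `B₂₁ + B₃₂ + B₄₃ = 0` (0-indexed: `B 3 0`, `B 2 0 + B 3 1`,
`B 1 0 + B 2 1 + B 3 2`) — the first row of `J³B + J²BJ + JBJ² + BJ³`. [NOTE-iota4 §2] -/
theorem constraints_of_J4 (V : Submodule ℂ (Matrix (Fin 4) (Fin 4) ℂ)) (hV : ∀ M ∈ V, M ^ 4 = 0)
    (hJ : (!![0, 1, 0, 0; 0, 0, 1, 0; 0, 0, 0, 1; 0, 0, 0, 0] : Matrix (Fin 4) (Fin 4) ℂ) ∈ V)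
    (B : Matrix (Fin 4) (Fin 4) ℂ) (hB : B ∈ V) :
    B 3 0 = 0 ∧ B 2 0 + B 3 1 = 0 ∧ B 1 0 + B 2 1 + B 3 2 = 0 := by
  set J : Matrix (Fin 4) (Fin 4) ℂ := !![0, 1, 0, 0; 0, 0, 1, 0; 0, 0, 0, 1; 0, 0, 0, 0] with hJdef
  have hL := firstOrder_of_pow_four J B (hV J hJ) (hV B hB) (hV _ (V.add_mem hJ hB)) (hV _ (V.sub_mem hJ hB))
    (hV _ (V.add_mem (V.add_mem hJ hB) hB))
  have h00 := congrFun (congrFun hL 0) 0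
  have h01 := congrFun (congrFun hL 0) 1
  have h02 := congrFun (congrFun hL 0) 2
  simp only [Matrix.add_apply, Matrix.mul_apply, Fin.sum_univ_four, Matrix.zero_apply] at h00 h01 h02
  simp [hJdef] at h00 h01 h02
  exact ⟨h00, by linear_combination h01, by linear_combination h02⟩

/-! ## §3 `p = 3`: the constraints `V ⊆ T(E₁₂ + E₂₃)` -/

/-- **`V ⊆ T(A)`, `A = E₁₂ + E₂₃`** (NOTE-iota4 §3): if `V ∋ A` is a linear space on which `M³ ≡ 0`, then every
`B ∈ V` satisfies `B₃₁ = 0`, `B₄₁ = 0`, `B₃₄ = 0`, `B₃₂ + B₂₁ = 0`, `B₁₁ + B₂₂ + B₃₃ = 0` (0-indexed below) — the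
entries of `A²B + ABA + BA²`. [NOTE-iota4 §3] -/
theorem constraints_of_E12_E23 (V : Submodule ℂ (Matrix (Fin 4) (Fin 4) ℂ)) (hV : ∀ M ∈ V, M ^ 3 = 0)
    (hA : (!![0, 1, 0, 0; 0, 0, 1, 0; 0, 0, 0, 0; 0, 0, 0, 0] : Matrix (Fin 4) (Fin 4) ℂ) ∈ V)
    (B : Matrix (Fin 4) (Fin 4) ℂ) (hB : B ∈ V) :
    B 2 0 = 0 ∧ B 3 0 = 0 ∧ B 2 3 = 0 ∧ B 2 1 + B 1 0 = 0 ∧ B 0 0 + B 1 1 + B 2 2 = 0 := by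
  set A : Matrix (Fin 4) (Fin 4) ℂ := !![0, 1, 0, 0; 0, 0, 1, 0; 0, 0, 0, 0; 0, 0, 0, 0] with hAdef
  have hL := firstOrder_of_cube A B (hV B hB) (hV _ (V.add_mem hA hB)) (hV _ (V.sub_mem hA hB))
  have h00 := congrFun (congrFun hL 0) 0
  have h01 := congrFun (congrFun hL 0) 1
  have h02 := congrFun (congrFun hL 0) 2
  have h03 := congrFun (congrFun hL 0) 3
  have h32 := congrFun (congrFun hL 3) 2
  simp only [Matrix.add_apply, Matrix.mul_apply, Fin.sum_univ_four, Matrix.zero_apply] at h00 h01 h02 h03 h32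
  simp [hAdef] at h00 h01 h02 h03 h32
  exact ⟨h00, h32, h03, by linear_combination h01, by linear_combination h02⟩

/-- With the trace: under the hypotheses of `constraints_of_E12_E23` also `B₄₄ = 0`. [NOTE-iota4 §3] -/
theorem entry33_eq_zero_of_E12_E23 (V : Submodule ℂ (Matrix (Fin 4) (Fin 4) ℂ)) (hV : ∀ M ∈ V, M ^ 3 = 0)
    (hA : (!![0, 1, 0, 0; 0, 0, 1, 0; 0, 0, 0, 0; 0, 0, 0, 0] : Matrix (Fin 4) (Fin 4) ℂ) ∈ V)
    (B : Matrix (Fin 4) (Fin 4) ℂ) (hB : B ∈ V) : B 3 3 = 0 := by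
  obtain ⟨-, -, -, -, h⟩ := constraints_of_E12_E23 V hV hA B hB
  have ht := trace_eq_zero_of_pow_eq_zero B (hV B hB)
  rw [Matrix.trace, Fin.sum_univ_four] at ht
  simp only [Matrix.diag_apply] at ht
  linear_combination ht - h

/-! ## §4 The two endings -/

/-- **Ending 1 (invariant hyperplane).**  If every member of `V` has zero last row, then every member maps `ℂ⁴` into
the hyperplane `{x₄ = 0}`, which is therefore a common invariant subspace. [NOTE-iota4 §2c] -/
theorem mulVec_last_eq_zero_of_row_zero (V : Submodule ℂ (Matrix (Fin 4) (Fin 4) ℂ))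
    (hrow : ∀ B ∈ V, ∀ j, B 3 j = 0) (B : Matrix (Fin 4) (Fin 4) ℂ) (hB : B ∈ V) (v : Fin 4 → ℂ) :
    (B *ᵥ v) 3 = 0 := by
  simp [Matrix.mulVec, dotProduct, hrow B hB]

/-- **Ending 2 (kernel line).**  If every member of `V` has zero first column, then `e₁` is a common kernel vector.
[NOTE-iota4 §2c/§3] -/
theorem mulVec_single_eq_zero_of_col_zero (V : Submodule ℂ (Matrix (Fin 4) (Fin 4) ℂ))
    (hcol : ∀ B ∈ V, ∀ i, B i 0 = 0) (B : Matrix (Fin 4) (Fin 4) ℂ) (hB : B ∈ V) :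
    B *ᵥ (Pi.single 0 1 : Fin 4 → ℂ) = 0 := by
  ext i
  simp [Matrix.mulVec, hcol B hB]

/-- **Ending 2′ (diagonal entry of a nilpotent with a coordinate row).**  If row `4` of a nilpotent `B` is `d·e₄ᵀ`
(all off-diagonal entries of the last row vanish) then `d = B₄₄ = 0` — `e₄ᵀ` would be a left eigenvector. [NOTE-iota4 §2c] -/
theorem entry33_eq_zero_of_last_row_diag (B : Matrix (Fin 4) (Fin 4) ℂ) {p : ℕ} (hB : B ^ p = 0)
    (h0 : B 3 0 = 0) (h1 : B 3 1 = 0) (h2 : B 3 2 = 0) : B 3 3 = 0 := by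
  -- row 3 of B^k is (B 3 3)^k · e₃ᵀ
  have hrow : ∀ k : ℕ, ∀ j, (B ^ k) 3 j = (B 3 3) ^ k * (if j = 3 then 1 else 0) := by
    intro k
    induction k with
    | zero => intro j; fin_cases j <;> simp
    | succ k ih =>
        intro j
        rw [pow_succ, Matrix.mul_apply, Fin.sum_univ_four, ih 0, ih 1, ih 2, ih 3]
        fin_cases j <;> simp [h0, h1, h2, pow_succ]
  have := hrow p 3
  rw [hB, Matrix.zero_apply] at this
  simp at this
  rcases Nat.eq_zero_or_pos p with hp | hp
  · subst hp; exact absurd hB one_ne_zero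
  · exact (pow_eq_zero_iff hp.ne').mp this.symm

/-! ## §5 (appended 18:05Z, htc-lead 17:49:57Z (b)) The continuant of NOTE-iota4 §2a -/

/-- **§2a continuant.**  For the tridiagonal `M = sJ₄ + aE₂₁ + bE₃₂ + cE₄₃` (0-indexed entries `(1,0),(2,1),(3,2)`)
one has `(M⁴)₁₁ = s²a(a+b)`; so if `a + b + c = 0` (the (T1) constraint) and `M⁴ = 0` then `s²·ac = 0`
(the characteristic polynomial is `λ⁴ − s(a+b+c)λ² + s²ac`). [NOTE-iota4 §2a] -/
theorem continuant_J4 (s a b c : ℂ) (habc : a + b + c = 0)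
    (h : (!![0, s, 0, 0; a, 0, s, 0; 0, b, 0, s; 0, 0, c, 0] : Matrix (Fin 4) (Fin 4) ℂ) ^ 4 = 0) :
    s ^ 2 * (a * c) = 0 := by
  have h00 := congrFun (congrFun h 0) 0
  simp only [pow_succ, pow_zero, Matrix.one_mul, Matrix.mul_apply, Fin.sum_univ_four, Matrix.zero_apply] at h00
  simp [-mul_eq_zero] at h00
  linear_combination s ^ 2 * a * habc - h00

/-- Hence for `s ≠ 0`: `ac = 0` — inside the plane `a + b + c = 0` the admissible lower parts lie on the two LINES
`ℂ(1,−1,0) ∪ ℂ(0,1,−1)`, which contain no plane (`exists_abc_ac_ne_zero`), so `dim U₋₁ ≤ 1`. [NOTE-iota4 §2a] -/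
theorem ac_eq_zero_of_continuant_J4 (s a b c : ℂ) (hs : s ≠ 0) (habc : a + b + c = 0)
    (h : (!![0, s, 0, 0; a, 0, s, 0; 0, b, 0, s; 0, 0, c, 0] : Matrix (Fin 4) (Fin 4) ℂ) ^ 4 = 0) :
    a * c = 0 := by
  have := continuant_J4 s a b c habc h
  rcases mul_eq_zero.mp this with h2 | h2
  · exact absurd (pow_eq_zero_iff two_ne_zero |>.mp h2) hs
  · exact h2

/-- The plane `a + b + c = 0` is not contained in `{ac = 0}`: witness `(1, −2, 1)`. [NOTE-iota4 §2a] -/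
theorem exists_abc_ac_ne_zero : ∃ a b c : ℂ, a + b + c = 0 ∧ a * c ≠ 0 :=
  ⟨1, -2, 1, by norm_num, by norm_num⟩

end Summit.ValiantsHypothesis.ValiantsHypothesis.Theorems.GrenetZeon.HeavyTopIotaFour

end
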